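import Summits.QuantumAdvantage.QuantumAdvantage.Theorems.CubicForrelationNearExactIsExactTwelveLevelFiveAlphaDead
import Summits.QuantumAdvantage.QuantumAdvantage.Theorems.CubicForrelationNearExactIsExactTwelveTypeOPairTame

/-!
# Crux `CubicForrelation.NearExactIsExact` (stmt-QuantumAdvantage-14043) — n = 12: the SHAPE OF A WINDOW PAIR after gen 30 —
  both sides TYPE O, and a WILD point on some side

Certificate seat `b2b-cforr-cert` (gen 30).  HONEST FRAMING: packaging (standard axioms) of `tz30_window_pair_typeO` (…TwelveLevelFiveAlphaDead:
case α is dead, every window side is type O) and `top_tame_false` (…TwelveTypeOPairTame: no tame (O,O) pair).  NO new value of `θ₁₂`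
(`∈ [57/64, 29/32)`); a finite-slice structure theorem, NOT summit progress.  Successor plan: HOME/b2b-cforr-cert-g30/PLAN-N12-WINDOW-OO.md.

* `tz30_window_shape`: cubic `f, g` on 12 bits with `57/64 < Φ(f,g) < 1` ⇒ `W_g = 16u_g`, `W_f = 16u_f` with all values odd, and some point is
  WILD: `(u_g(x) − 4(−1)^{f(x)})² > 9` for some `x` or `(u_f(y) − 4(−1)^{g(y)})² > 9` for some `y`.
-/

set_option linter.dupNamespace false -- D-0017: single-problem summit ⇒ `QuantumAdvantage.QuantumAdvantage` by design

noncomputable section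

namespace Summit.QuantumAdvantage.QuantumAdvantage.Theorems.CubicForrelation.NearExactIsExact

open Finset
open Literature.Computability.QuantumComplexity
open Literature.Computability.QuantumComplexity.DerivativeWalsh (W)

/-- **Shape of a window pair (n = 12, after gen 30).**  Cubic `f, g` with `57/64 < Φ(f,g) < 1`: both Walsh spectra are `16 ×` odd (type O),
and the pair is not tame — some `x` has `(u_g(x) − 4(−1)^{f(x)})² > 9` or some `y` has `(u_f(y) − 4(−1)^{g(y)})² > 9`.  Finite-slice
statement, NOT summit progress. [this work] -/
theorem tz30_window_shape (f g : (Fin (6 + 6) → Bool) → Bool) (hf : IsDegLeFun 3 f) (hg : IsDegLeFun 3 g)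
    (hlo : (57 / 64 : ℝ) < forrelation f g) (hhi : forrelation f g < 1) :
    ∃ u_g u_f : (Fin (6 + 6) → Bool) → ℤ,
      (∀ x, W (fun y => signOf (g y)) x = (2 : ℝ) ^ 4 * (u_g x : ℝ)) ∧ (∀ x, Odd (u_g x)) ∧
      (∀ y, W (fun x => signOf (f x)) y = (2 : ℝ) ^ 4 * (u_f y : ℝ)) ∧ (∀ y, Odd (u_f y)) ∧
      ((∃ x, 9 < (u_g x - 4 * sZ (f x)) ^ 2) ∨ (∃ y, 9 < (u_f y - 4 * sZ (g y)) ^ 2)) := by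
  obtain ⟨⟨u_f, hu_f, ho_f⟩, ⟨u_g, hu_g, ho_g⟩⟩ := tz30_window_pair_typeO f g hf hg hlo hhi
  refine ⟨u_g, u_f, hu_g, ho_g, hu_f, ho_f, ?_⟩
  by_contra h
  push Not at h
  obtain ⟨h1, h2⟩ := h
  exact top_tame_false g f hg hf u_g u_f hu_g hu_f ho_g ho_f h1 h2

end Summit.QuantumAdvantage.QuantumAdvantage.Theorems.CubicForrelation.NearExactIsExact

end
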